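import Mathlib
import HarnessLib
import Literature.Probability.Process.HarrisTheorem
import Literature.MathematicalPhysics.KineticTheory.FouriersLaw

/-!
# A Poisson-equation bound from Hairer–Mattingly's contraction (helper for stub CONT
`stub_flipMildContinuity`, line `fekete-usc-one-length`, crux stmt-AtomisticToContinuum-11976)

`--supports stmt-AtomisticToContinuum-11976` helper file (crux `VanishingNoiseBound`, route
`VanishingNoiseTransfer`, line `fekete-usc-one-length`, stub CONT, wave 5). Abstract Markov-kernel facts used by
the perturbation argument of CONT (continuity of the centred mild forward family in the bath temperatures):

* `poisson_lipschitz_le` — if a Markov kernel `P` contracts the `d_β`-Lipschitz seminorm by `ᾱ < 1`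
  (`d_β(x,y) = 2 + βV(x) + βV(y)`, the conclusion of `Harris.exists_contraction` / `Harris.abs_integral_sub_integral_le`)
  and a `d_β`-Lipschitz measurable `D` solves the Poisson-type equation `D = P D + E` with a `d_β`-Lipschitz `E` of
  constant `M_E`, then `D` is `d_β`-Lipschitz with constant `M_E/(1-ᾱ)` — independently of the a-priori constant of `D`
  (iterate `⦀D⦀ ≤ ᾱ⦀D⦀ + ⦀E⦀`).
* `abs_sub_integral_le_of_lipschitz` — a `d_β`-Lipschitz `φ` is within `M(2 + βV(x) + βμ(V))` of its mean `μ(φ)`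
  under any probability measure `μ` with `∫ V dμ < ∞`.
* `lipschitz_of_abs_le_mul`, `lipschitz_of_abs_le_affine` — weighted sup / affine bounds give `d_β`-Lipschitz
  constants.
* `helper_flipMildContinuityPoisson` — registered helper (notation-free restatement of `poisson_lipschitz_le`).

References: Hairer–Mattingly 2011 (Thm 1.3, Lemma 2.1); Meyn–Tweedie Ch. 17 (Poisson equation).
-/

noncomputable section

open MeasureTheory ProbabilityTheory Filter Topology Set Literature.Probability.Process
open scoped NNReal ENNReal Topology

namespace Summit.AtomisticToContinuum.FouriersLaw.Theorems.VanishingNoiseBound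

variable {X : Type*} [MeasurableSpace X]

/-- **Lipschitz bound for solutions of a Poisson-type equation from the Hairer–Mattingly contraction.** Let `P`
be a Markov kernel contracting the `d_β`-Lipschitz seminorm by `ᾱ ∈ [0,1)`: for every measurable `φ` and `M ≥ 0`,
`|φ(x) − φ(y)| ≤ M d_β(x,y)` for all `x,y` implies `|Pφ(x) − Pφ(y)| ≤ ᾱ M d_β(x,y)`. If `D` is measurable and
`M_D`-Lipschitz, `E` is `M_E`-Lipschitz (`M_D, M_E, β ≥ 0`) and `D(x) = (PD)(x) + E(x)` for all `x`, then `D` is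
`M_E/(1−ᾱ)`-Lipschitz for `d_β`. [cite: HairerMattingly2011, Theorem 1.3] -/
theorem poisson_lipschitz_le (P : Kernel X X) [IsMarkovKernel P] {V : X → ℝ≥0} {abar β : ℝ}
    (habar0 : 0 ≤ abar) (habar1 : abar < 1)
    (hcontr : ∀ (φ : X → ℝ), Measurable φ → ∀ M : ℝ, 0 ≤ M →
      (∀ x y, |φ x - φ y| ≤ M * (2 + β * V x + β * V y)) →
      ∀ x y, |∫ z, φ z ∂(P x) - ∫ z, φ z ∂(P y)| ≤ abar * M * (2 + β * V x + β * V y))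
    {D E : X → ℝ} (hDm : Measurable D) {M_D M_E : ℝ} (hMD : 0 ≤ M_D) (hME : 0 ≤ M_E)
    (hD : ∀ x y, |D x - D y| ≤ M_D * (2 + β * V x + β * V y))
    (hE : ∀ x y, |E x - E y| ≤ M_E * (2 + β * V x + β * V y))
    (heq : ∀ x, D x = ∫ z, D z ∂(P x) + E x) (hβ : 0 ≤ β) :
    ∀ x y, |D x - D y| ≤ M_E / (1 - abar) * (2 + β * V x + β * V y) := by
  -- the iteration `M_{n+1} = ᾱ M_n + M_E`, dominated by `ᾱⁿ M_D + M_E/(1-ᾱ)`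
  have h1a : 0 < 1 - abar := by linarith
  have hd : ∀ x y, 0 ≤ 2 + β * V x + β * V y := fun x y => by positivity
  have hstep : ∀ M : ℝ, 0 ≤ M → (∀ x y, |D x - D y| ≤ M * (2 + β * V x + β * V y)) →
      ∀ x y, |D x - D y| ≤ (abar * M + M_E) * (2 + β * V x + β * V y) := by
    intro M hM hDM x y
    have h1 := hcontr D hDm M hM hDM x y
    have h2 := hE x y
    rw [heq x, heq y]
    calc |∫ z, D z ∂(P x) + E x - (∫ z, D z ∂(P y) + E y)|
        = |(∫ z, D z ∂(P x) - ∫ z, D z ∂(P y)) + (E x - E y)| := by ring_nf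
      _ ≤ |∫ z, D z ∂(P x) - ∫ z, D z ∂(P y)| + |E x - E y| := abs_add_le _ _
      _ ≤ abar * M * (2 + β * V x + β * V y) + M_E * (2 + β * V x + β * V y) := add_le_add h1 h2
      _ = (abar * M + M_E) * (2 + β * V x + β * V y) := by ring
  have hiter : ∀ n : ℕ, ∀ x y, |D x - D y| ≤ (abar ^ n * M_D + M_E / (1 - abar)) * (2 + β * V x + β * V y) := by
    intro n
    induction n with
    | zero =>
      intro x y
      refine (hD x y).trans (mul_le_mul_of_nonneg_right ?_ (hd x y))
      rw [pow_zero, one_mul]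
      exact le_add_of_nonneg_right (div_nonneg hME h1a.le)
    | succ n ih =>
      intro x y
      have hMn : 0 ≤ abar ^ n * M_D + M_E / (1 - abar) := by positivity
      refine (hstep _ hMn ih x y).trans (mul_le_mul_of_nonneg_right ?_ (hd x y))
      have e1 : abar * (abar ^ n * M_D + M_E / (1 - abar)) + M_E =
          abar ^ (n + 1) * M_D + M_E / (1 - abar) := by
        field_simp
        ring
      rw [e1]
  intro x y
  have hlim : Tendsto (fun n : ℕ => (abar ^ n * M_D + M_E / (1 - abar)) * (2 + β * V x + β * V y)) atTop
      (𝓝 ((0 * M_D + M_E / (1 - abar)) * (2 + β * V x + β * V y))) :=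
    (((tendsto_pow_atTop_nhds_zero_of_lt_one habar0 habar1).mul_const M_D).add_const _).mul_const _
  rw [zero_mul, zero_add] at hlim
  exact ge_of_tendsto' hlim fun n => hiter n x y

/-- **A `d_β`-Lipschitz function is close to its mean**: if `|φ(x) − φ(y)| ≤ M d_β(x,y)` for all `x, y`,
`φ` is measurable, and `μ` is a probability measure with `∫ V dμ < ∞`, then
`|φ(x) − ∫ φ dμ| ≤ M (2 + βV(x) + β ∫ V dμ)` (integrate the Lipschitz bound in `y`).
[cite: HairerMattingly2011, Theorem 1.2] -/
theorem abs_sub_integral_le_of_lipschitz {V : X → ℝ≥0} (hV : Measurable V) {β M : ℝ}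
    {μ : Measure X} [IsProbabilityMeasure μ] (hVμ : ∫⁻ x, V x ∂μ ≠ ∞) {φ : X → ℝ} (hφm : Measurable φ)
    (hφ : ∀ x y, |φ x - φ y| ≤ M * (2 + β * V x + β * V y)) (x : X) :
    |φ x - ∫ y, φ y ∂μ| ≤ M * (2 + β * V x + β * (∫⁻ y, V y ∂μ).toReal) := by
  have hVi : Integrable (fun z => (V z : ℝ)) μ := Harris.integrable_coe_of_lintegral_ne_top hV hVμ
  have hφi : Integrable φ μ :=
    Harris.integrable_of_abs_le_affine hV hVμ hφm (Harris.abs_le_affine_of_lipschitz hφ x)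
  have hsub : φ x - ∫ y, φ y ∂μ = ∫ y, (φ x - φ y) ∂μ := by
    rw [integral_sub (integrable_const _) hφi, integral_const, probReal_univ, one_smul]
  rw [hsub]
  calc |∫ y, (φ x - φ y) ∂μ| ≤ ∫ y, |φ x - φ y| ∂μ := abs_integral_le_integral_abs
    _ ≤ ∫ y, M * (2 + β * V x + β * V y) ∂μ := by
        refine integral_mono ((integrable_const _).sub hφi).abs ?_ fun y => hφ x y
        exact ((integrable_const _).add (hVi.const_mul _)).const_mul _
    _ = M * (2 + β * V x + β * (∫⁻ y, V y ∂μ).toReal) := by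
        rw [integral_const_mul, integral_add (integrable_const _) (hVi.const_mul _), integral_const,
          probReal_univ, one_smul, integral_const_mul, Harris.integral_coe_eq_toReal hV]

omit [MeasurableSpace X] in
/-- **From a weighted sup bound to a `d_β`-Lipschitz bound**: `|φ| ≤ e·V` with `e ≥ 0`, `β > 0` gives
`|φ(x) − φ(y)| ≤ (e/β)(2 + βV(x) + βV(y))`. [folklore] -/
theorem lipschitz_of_abs_le_mul {V : X → ℝ≥0} {β e : ℝ} (hβ : 0 < β) (he : 0 ≤ e) {φ : X → ℝ}
    (hφ : ∀ x, |φ x| ≤ e * V x) (x y : X) :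
    |φ x - φ y| ≤ e / β * (2 + β * V x + β * V y) := by
  have h1 := hφ x
  have h2 := hφ y
  have h3 : |φ x - φ y| ≤ |φ x| + |φ y| := abs_sub _ _
  have h4 : e / β * (2 + β * V x + β * V y) = 2 * (e / β) + e * V x + e * V y := by
    field_simp
  rw [h4]
  have h5 : 0 ≤ 2 * (e / β) := by positivity
  linarith

omit [MeasurableSpace X] in
/-- **From an affine bound to a `d_β`-Lipschitz bound**: `|φ| ≤ A + B·V` with `A, B ≥ 0`, `β > 0` gives
`|φ(x) − φ(y)| ≤ (A + B/β)(2 + βV(x) + βV(y))`. [folklore] -/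
theorem lipschitz_of_abs_le_affine {V : X → ℝ≥0} {β A B : ℝ} (hβ : 0 < β) (hA : 0 ≤ A) (hB : 0 ≤ B)
    {φ : X → ℝ} (hφ : ∀ x, |φ x| ≤ A + B * V x) (x y : X) :
    |φ x - φ y| ≤ (A + B / β) * (2 + β * V x + β * V y) := by
  have h1 := hφ x
  have h2 := hφ y
  have h3 : |φ x - φ y| ≤ |φ x| + |φ y| := abs_sub _ _
  have hVx : (0 : ℝ) ≤ V x := (V x).coe_nonneg
  have hVy : (0 : ℝ) ≤ V y := (V y).coe_nonneg
  have h4 : (A + B / β) * (2 + β * V x + β * V y) =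
      2 * A + A * β * V x + A * β * V y + 2 * (B / β) + B * V x + B * V y := by
    field_simp
    ring
  rw [h4]
  have h5 : 0 ≤ 2 * (B / β) := by positivity
  have h6 : 0 ≤ A * β * V x := by positivity
  have h7 : 0 ≤ A * β * V y := by positivity
  linarith

/-! ## Registered helper -/

/-- Registered helper sub-goal `helper_flipMildContinuityPoisson` of stub `stub_flipMildContinuity` (line
`fekete-usc-one-length`, crux stmt-AtomisticToContinuum-11976): the Poisson/Lipschitz bound `poisson_lipschitz_le`
on phase space (notation-free one-line form). -/
theorem helper_flipMildContinuityPoisson : ∀ (N : ℕ) (P : ProbabilityTheory.Kernel (Literature.MathematicalPhysics.KineticTheory.HeatConduction.PhaseSpace N) (Literature.MathematicalPhysics.KineticTheory.HeatConduction.PhaseSpace N)) [ProbabilityTheory.IsMarkovKernel P] (V : Literature.MathematicalPhysics.KineticTheory.HeatConduction.PhaseSpace N → NNReal) (abar β : ℝ), 0 ≤ abar → abar < 1 → 0 ≤ β → (∀ φ : Literature.MathematicalPhysics.KineticTheory.HeatConduction.PhaseSpace N → ℝ, Measurable φ → ∀ M : ℝ, 0 ≤ M → (∀ x y, |φ x -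 φ y| ≤ M * (2 + β * (V x : ℝ) + β * (V y : ℝ))) → ∀ x y, |MeasureTheory.integral (P x) (fun z => φ z) - MeasureTheory.integral (P y) (fun z => φ z)| ≤ abar * M * (2 + β * (V x : ℝ) + β * (V y : ℝ))) → ∀ (D E : Literature.MathematicalPhysics.KineticTheory.HeatConduction.PhaseSpace N → ℝ), Measurable D → ∀ (M_D M_E : ℝ), 0 ≤ M_D → 0 ≤ M_E → (∀ x y, |D x - D y| ≤ M_D * (2 + β * (V x : ℝ) + β * (V y : ℝ))) → (∀ x y, |E x - E y| ≤ M_E * (2 + β * (V x : ℝ) + β * (V y : ℝ))) → (∀ x, D x = MeasureTheory.integral (P x) (fun z => D z) + E x) → ∀ x y, |D x - D y| ≤ M_E / (1 - abar) * (2 + β * (V x : ℝ) + β * (V y : ℝ)) :=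
  fun _ P _ _ _ _ h0 h1 hβ hcontr _ _ hDm _ _ hMD hME hD hE heq =>
    poisson_lipschitz_le P h0 h1 hcontr hDm hMD hME hD hE heq hβ

end Summit.AtomisticToContinuum.FouriersLaw.Theorems.VanishingNoiseBound

end
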